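import Literature.AlgebraicGeometry.Modules.SheafHomExact
import Mathlib.Topology.Sheaves.Flasque
import Mathlib.Algebra.Category.Grp.EpiMono
import Mathlib.Order.Zorn
import HarnessLib

/-!
# `𝓗om(E, ℐ)` is flasque for `E` finite locally free and `ℐ` flasque

For a scheme `X`, a finite locally free `𝒪_X`-module `E` and an `𝒪_X`-module `ℐ` whose underlying
abelian sheaf is flasque, the internal Hom `𝓗om_{𝒪_X}(E, ℐ)` (`Modules.sheafHom E ℐ`,
`U ↦ Hom(E|_U, ℐ|_U)`) is again flasque: every morphism `E|_V → ℐ|_V` extends to `E|_U → ℐ|_U` for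
opens `V ⊆ U`. Locally this is clear — where `E|_{U'} ≅ 𝒪^n`, a morphism is an `n`-tuple of sections
of `ℐ`, which extend because `ℐ` is flasque (`exists_restrictHom_eq_of_trivialisation`) — and
flasqueness is a local property: a maximal partial extension (Zorn's lemma over the partial
extensions `PartialExtension`, ordered by restriction; chains glue by the sheaf property of
`𝓗om`, `Modules.glueHom`) is defined on all of `U`, for otherwise it extends further across a
trivialising neighbourhood of a missing point (Godement, *Topologie algébrique et théorie des
faisceaux*, II Thm. 3.1.2: "flasque" is a local property; Hartshorne III.6.3/6.7 use
`𝓗om(ℒ, ℐ)` injective, hence flasque, for `ℒ` locally free — here we record the weaker flasque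
statement, which needs no injectivity of `ℐ`).

* `map_surjective_of_isFlasque` — restriction maps of a module with flasque underlying sheaf are
  surjective;
* `exists_restrictHom_eq_of_trivialisation` — the local extension across a trivialising open;
* `PartialExtension φ U` — partial extensions of `φ : E|_V → ℐ|_V` to opens between `V` and `U`,
  a preorder under restriction; `PartialExtension.exists_isMax` (Zorn), `PartialExtension.le_W_of_isMax`
  (a maximal one is defined on `U`);
* `restrictHom_surjective_of_isFlasque` — **`Hom(E|_U, ℐ|_U) → Hom(E|_V, ℐ|_V)` is onto**;
* `isFlasque_sheafHom` — **`𝓗om(E, ℐ)` is flasque**.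

## References

* R. Godement, *Topologie algébrique et théorie des faisceaux* (1958), II 3.1 (flasque sheaves;
  Thm. 3.1.2, locality). [Godement1958]
* R. Hartshorne, *Algebraic Geometry* (1977), II Ex. 1.16, III Prop. 6.7 (proof: `𝓗om(ℒ, ℐ)`
  for `ℒ` locally free and `ℐ` injective). [Hartshorne1977]
-/

noncomputable section

universe u

open CategoryTheory CategoryTheory.Limits Opposite TopologicalSpace AlgebraicGeometry

namespace Literature.AlgebraicGeometry.Modules

open Literature.AlgebraicGeometry.Motives

variable {X : Scheme.{u}} {E : X.Modules}

/-! ### Flasque modules: restriction of sections is onto -/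

section Flasque

/-- If the underlying abelian sheaf of an `𝒪_X`-module `ℐ` is flasque, its restriction maps
`Γ(ℐ, U) → Γ(ℐ, V)` are surjective. [folklore] -/
theorem map_surjective_of_isFlasque (I : X.Modules)
    [hI : TopCat.Sheaf.IsFlasque ((SheafOfModules.toSheaf X.ringCatSheaf).obj I)]
    {V U : X.Opens} (i : V ⟶ U) : Function.Surjective (I.presheaf.map i.op) := by
  rw [← AddCommGrpCat.epi_iff_surjective]
  exact hI.epi i.op

end Flasque

/-! ### The local extension across a trivialising open -/

section Local

variable {I : X.Modules} [TopCat.Sheaf.IsFlasque ((SheafOfModules.toSheaf X.ringCatSheaf).obj I)]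

/-- **Local extension.** If `E|_{U'} ≅ 𝒪^ι` is trivial on `U'` and `ℐ` is flasque, every morphism
`ψ : E|_W → ℐ|_W` on an open `W ⊆ U'` is the restriction of a morphism `E|_{U'} → ℐ|_{U'}`: extend
the images `ψ(b_j|_W) ∈ Γ(ℐ, W)` of the basis sections to `U'` and map the basis there.
[cite: Hartshorne1977, III Prop. 6.7 (proof)] -/
theorem exists_restrictHom_eq_of_trivialisation {U' W : X.Opens} {ι : Type u}
    (e : SheafOfModules.free ι ≅ E.over U') (k : W ⟶ U') (ψ : E.over W ⟶ I.over W) :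
    ∃ ψ' : E.over U' ⟶ I.over U', restrictHom k ψ' = ψ := by
  let eW : SheafOfModules.free ι ≅ E.over W :=
    SheafOfModules.restrictTrivialisation (R := X.ringCatSheaf) k e
  -- extend the images of the basis sections
  choose t ht using fun j => map_surjective_of_isFlasque I k (appLE ψ (𝟙 W) (basisSection eW j))
  refine ⟨homOfBasisValues e t, hom_ext_of_basisSection eW fun j => ?_⟩
  rw [appLE_restrictHom, Category.id_comp]
  have hb : basisSection eW j = E.presheaf.map k.op (basisSection e j) :=
    basisSection_restrictTrivialisation k e j
  conv_lhs => rw [hb, appLE_congr_hom _ k (k ≫ 𝟙 U'), appLE_map, appLE_homOfBasisValues]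
  exact ht j

end Local

/-! ### Partial extensions and Zorn's lemma -/

section Zorn

variable (I : X.Modules) {V : X.Opens} (φ : E.over V ⟶ I.over V)

/-- A **partial extension** of `φ : E|_V → ℐ|_V` towards `U`: an open `W` with `V ⊆ W ⊆ U` and a
morphism `ψ : E|_W → ℐ|_W` restricting to `φ`. [folklore] -/
structure PartialExtension (U : X.Opens) where
  /-- the open of definition -/
  W : X.Opens
  /-- it contains `V` -/
  hVW : V ≤ W
  /-- it is contained in `U` -/
  hWU : W ≤ U
  /-- the partial extension -/
  ψ : E.over W ⟶ I.over W
  /-- it restricts to `φ` -/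
  hψ : restrictHom (homOfLE hVW) ψ = φ

namespace PartialExtension

variable {I φ} {U : X.Opens}

/-- Partial extensions are ordered by restriction. [folklore] -/
instance : Preorder (PartialExtension I φ U) where
  le a b := a.W ≤ b.W ∧ ∀ h : a.W ≤ b.W, restrictHom (homOfLE h) b.ψ = a.ψ
  le_refl a := ⟨le_rfl, fun h => by
    rw [show homOfLE h = 𝟙 a.W from Subsingleton.elim _ _, restrictHom_id']⟩
  le_trans a b c hab hbc := ⟨hab.1.trans hbc.1, fun h => by
    rw [show homOfLE h = homOfLE hab.1 ≫ homOfLE hbc.1 from Subsingleton.elim _ _,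
      restrictHom_comp', hbc.2 hbc.1, hab.2 hab.1]⟩

/-- Unfolding the order. [folklore] -/
theorem le_def (a b : PartialExtension I φ U) :
    a ≤ b ↔ a.W ≤ b.W ∧ ∀ h : a.W ≤ b.W, restrictHom (homOfLE h) b.ψ = a.ψ := Iff.rfl

/-- The trivial partial extension `(V, φ)`. [folklore] -/
def bot (hVU : V ≤ U) : PartialExtension I φ U where
  W := V
  hVW := le_rfl
  hWU := hVU
  ψ := φ
  hψ := by rw [show homOfLE (le_refl V) = 𝟙 V from Subsingleton.elim _ _, restrictHom_id']

/-- **Chains of partial extensions are bounded above**: glue the members of a nonempty chain along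
the cover of `⨆ W_a` by the `W_a` (sheaf property of `𝓗om`, `Modules.glueHom`). [folklore] -/
theorem bddAbove_of_isChain (c : Set (PartialExtension I φ U)) (hc : IsChain (· ≤ ·) c)
    (hne : c.Nonempty) : BddAbove c := by
  obtain ⟨a₀, ha₀⟩ := hne
  let Wf : c → X.Opens := fun a => a.1.W
  let sf : ∀ a : c, E.over (Wf a) ⟶ I.over (Wf a) := fun a => a.1.ψ
  have hsf : ∀ a b : c, restrictHom (Opens.infLELeft (Wf a) (Wf b)) (sf a) =
      restrictHom (Opens.infLERight (Wf a) (Wf b)) (sf b) := by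
    intro a b
    change restrictHom (Opens.infLELeft a.1.W b.1.W) a.1.ψ =
      restrictHom (Opens.infLERight a.1.W b.1.W) b.1.ψ
    rcases hc.total a.2 b.2 with hab | hba
    · rw [← hab.2 hab.1, ← restrictHom_comp']
      exact congrArg (restrictHom · b.1.ψ) (Subsingleton.elim _ _)
    · rw [← hba.2 hba.1, ← restrictHom_comp']
      exact congrArg (restrictHom · a.1.ψ) (Subsingleton.elim _ _)
  have hle : ∀ a : c, a.1.W ≤ iSup Wf := fun a => le_iSup Wf a
  let ub : PartialExtension I φ U :=
    { W := iSup Wf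
      hVW := a₀.hVW.trans (hle ⟨a₀, ha₀⟩)
      hWU := iSup_le fun a => a.1.hWU
      ψ := glueHom Wf sf hsf
      hψ := by
        rw [show homOfLE (a₀.hVW.trans (hle ⟨a₀, ha₀⟩)) =
            homOfLE a₀.hVW ≫ Opens.leSupr Wf ⟨a₀, ha₀⟩ from Subsingleton.elim _ _,
          restrictHom_comp', restrictHom_glueHom]
        exact a₀.hψ }
  refine ⟨ub, fun a ha => ⟨hle ⟨a, ha⟩, fun h => ?_⟩⟩
  rw [show homOfLE h = Opens.leSupr Wf ⟨a, ha⟩ from Subsingleton.elim _ _]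
  exact restrictHom_glueHom Wf sf hsf ⟨a, ha⟩

/-- **A maximal partial extension exists** (Zorn's lemma). [folklore] -/
theorem exists_isMax (hVU : V ≤ U) : ∃ m : PartialExtension I φ U, IsMax m :=
  haveI : Nonempty (PartialExtension I φ U) := ⟨bot hVU⟩
  zorn_le_nonempty fun c hc hne => bddAbove_of_isChain c hc hne

variable [TopCat.Sheaf.IsFlasque ((SheafOfModules.toSheaf X.ringCatSheaf).obj I)]

/-- **A maximal partial extension is defined on all of `U`** when `E` is finite locally free and
`ℐ` is flasque: otherwise, at a point of `U` outside its open of definition `W`, trivialise `E` on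
`U₁ ⊆ U`, extend the restriction to `W ∩ U₁` across `U₁` (`exists_restrictHom_eq_of_trivialisation`)
and glue over `W ∪ U₁` — a strictly larger partial extension.
[cite: Godement1958, II Thm. 3.1.2] -/
theorem le_W_of_isMax (hE : IsFiniteLocallyFree E) (m : PartialExtension I φ U) (hm : IsMax m) :
    U ≤ m.W := by
  intro x hx
  by_contra hxW
  obtain ⟨U', hxU', ι, -, ⟨e⟩⟩ := hE x
  -- trivialise on `U₁ = U' ⊓ U` and extend `m.ψ|_{W ⊓ U₁}` across `U₁`
  let U₁ : X.Opens := U' ⊓ U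
  have hxU₁ : x ∈ U₁ := ⟨hxU', hx⟩
  let e₁ : SheafOfModules.free ι ≅ E.over U₁ :=
    SheafOfModules.restrictTrivialisation (R := X.ringCatSheaf) (Opens.infLELeft U' U) e
  obtain ⟨ψ₁, hψ₁⟩ := exists_restrictHom_eq_of_trivialisation e₁ (Opens.infLERight m.W U₁)
    (restrictHom (Opens.infLELeft m.W U₁) m.ψ)
  -- glue `m.ψ` and `ψ₁` over the cover `{W, U₁}` of `W ⊔ U₁`
  let P : ULift.{u} Bool → X.Opens := fun b => match b with
    | ⟨true⟩ => m.W
    | ⟨false⟩ => U₁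
  let sf : ∀ b, E.over (P b) ⟶ I.over (P b) := fun b => match b with
    | ⟨true⟩ => m.ψ
    | ⟨false⟩ => ψ₁
  have key : restrictHom (Opens.infLELeft m.W U₁) m.ψ =
      restrictHom (Opens.infLERight m.W U₁) ψ₁ := hψ₁.symm
  have key' : restrictHom (Opens.infLELeft U₁ m.W) ψ₁ =
      restrictHom (Opens.infLERight U₁ m.W) m.ψ := by
    let j : U₁ ⊓ m.W ⟶ m.W ⊓ U₁ := homOfLE (le_of_eq (inf_comm U₁ m.W))
    rw [show Opens.infLELeft U₁ m.W = j ≫ Opens.infLERight m.W U₁ from Subsingleton.elim _ _,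
      show Opens.infLERight U₁ m.W = j ≫ Opens.infLELeft m.W U₁ from Subsingleton.elim _ _,
      restrictHom_comp', restrictHom_comp', key]
  have hsf : ∀ b b', restrictHom (Opens.infLELeft (P b) (P b')) (sf b) =
      restrictHom (Opens.infLERight (P b) (P b')) (sf b') := by
    rintro ⟨_ | _⟩ ⟨_ | _⟩
    · exact congrArg (restrictHom · ψ₁) (Subsingleton.elim _ _)
    · exact key'
    · exact key
    · exact congrArg (restrictHom · m.ψ) (Subsingleton.elim _ _)
  have hWle : m.W ≤ iSup P := le_iSup P ⟨true⟩
  have hU₁le : U₁ ≤ iSup P := le_iSup P ⟨false⟩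
  let m₂ : PartialExtension I φ U :=
    { W := iSup P
      hVW := m.hVW.trans hWle
      hWU := iSup_le fun b => match b with
        | ⟨true⟩ => m.hWU
        | ⟨false⟩ => inf_le_right
      ψ := glueHom P sf hsf
      hψ := by
        rw [show homOfLE (m.hVW.trans hWle) = homOfLE m.hVW ≫ Opens.leSupr P ⟨true⟩ from
            Subsingleton.elim _ _, restrictHom_comp']
        exact (congrArg (restrictHom (homOfLE m.hVW)) (restrictHom_glueHom P sf hsf ⟨true⟩)).trans
          m.hψ }
  have hmm₂ : m ≤ m₂ := ⟨hWle, fun h => by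
    rw [show homOfLE h = Opens.leSupr P ⟨true⟩ from Subsingleton.elim _ _]
    exact restrictHom_glueHom P sf hsf ⟨true⟩⟩
  have h₂ : m₂.W ≤ m.W := (hm hmm₂).1
  exact hxW (h₂ (hU₁le hxU₁))

end PartialExtension

/-- **Extension of morphisms out of a finite locally free module into a flasque module**: for
`E` finite locally free, `ℐ` with flasque underlying sheaf and opens `V ⊆ U`, every
`φ : E|_V → ℐ|_V` is the restriction of some `E|_U → ℐ|_U` — i.e. the restriction maps of
`𝓗om(E, ℐ)` are surjective. [cite: Godement1958, II Thm. 3.1.2] -/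
theorem restrictHom_surjective_of_isFlasque (hE : IsFiniteLocallyFree E) (I : X.Modules)
    [TopCat.Sheaf.IsFlasque ((SheafOfModules.toSheaf X.ringCatSheaf).obj I)] {V U : X.Opens}
    (i : V ⟶ U) : Function.Surjective (restrictHom (E := E) (M := I) i) := by
  intro φ
  obtain ⟨m, hm⟩ := PartialExtension.exists_isMax (I := I) (φ := φ) i.le
  have hUW : U ≤ m.W := PartialExtension.le_W_of_isMax hE m hm
  refine ⟨restrictHom (homOfLE hUW) m.ψ, ?_⟩
  rw [← restrictHom_comp', show i ≫ homOfLE hUW = homOfLE m.hVW from Subsingleton.elim _ _]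
  exact m.hψ

end Zorn

/-! ### `𝓗om(E, ℐ)` is flasque -/

section SheafHom

/-- **`𝓗om_{𝒪_X}(E, ℐ)` is flasque for `E` finite locally free and `ℐ` flasque** (the underlying
abelian sheaf of `Modules.sheafHom E ℐ`, whose restriction maps are `restrictHom`).
[cite: Godement1958, II Thm. 3.1.2] -/
theorem isFlasque_sheafHom (hE : IsFiniteLocallyFree E) (I : X.Modules)
    [TopCat.Sheaf.IsFlasque ((SheafOfModules.toSheaf X.ringCatSheaf).obj I)] :
    TopCat.Sheaf.IsFlasque ((SheafOfModules.toSheaf X.ringCatSheaf).obj (sheafHom E I)) where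
  epi {U V} i := by
    rw [AddCommGrpCat.epi_iff_surjective]
    exact restrictHom_surjective_of_isFlasque hE I i.unop

end SheafHom

end Literature.AlgebraicGeometry.Modules

end
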